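import Summits.QuantumFields.BalabanUV.T4Continuum.Support.NE7SliceTheoremFrames
import Summits.QuantumFields.BalabanUV.T4Continuum.Support.NE7SliceRepresentative
import Summits.QuantumFields.BalabanUV.T4Continuum.Support.NE3TopRadiusLetters
import Summits.QuantumFields.BalabanUV.T4Continuum.Support.NE3ClassRadiusFamily
import HarnessLib

/-!
# NE7SliceRepresentativeFrames — STEP 0 (memo ROAD-G102 §9), second file: `NE7SliceRepresentative.slice_representative` re-issued over `NE7SliceTheoremFrames.slice_theorem_curved_fm`, i.e. with
# the two extra conclusions FRAME MATCHING `framePotW L (k+1) W (T(u⋆)) = h(u⋆)` and ZERO DEFECT `Df(u⋆) = 0` (stated over every proof argument of the state maps) — one smallness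
# hypothesis `ε ≤ ε₂`, k-free `ε₂, C_S`; the budget and the class lines are `NE7SliceRepresentative`'s BY NAME

Cell `pub-balaban`, rung (B)+1 sub-cell t4, lineage `b2b-balaban-t4-ne7-p1`, generation 102 (CRUX PROVER NE7 #1 = OWNER of BINDER row NE7).  Memo `t4/b2b-balaban-t4-ne7-p1-g102/ROAD-G102.md` §9.
WHAT ([folklore]; 0 def, 0 sorry).  **`slice_representative_fm`** (statement displayed).
HONEST FRAMING (page 1): bookkeeping over landed theorems; nothing of Bałaban's asserted; NOT (S2), NOT NE7; spine 0∕9; finite T⁴ rung (B)+1 — NOT infinite volume, NOT mass gap, NOT BetaPertH, NOT Clay.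
Continuum YM on T⁴ ⇐ BetaPertH ∧ nine spine estimates (0/9 proved); BetaPertH ⇐ (D1) ∧ (D4) ∧ CAP+tail; G-an2-4 gates asym, D1 and NE2/3/4.
-/


set_option autoImplicit false

open scoped BigOperators Matrix.Norms.L2Operator
open NormedSpace Finset

namespace Summit.QuantumFields.BalabanUV.T4Continuum.NE7SliceRepresentativeFrames

open Literature.MathematicalPhysics.QuantumFieldTheory.Balaban1983to89
open B7Prop1Explicit B7Prop2Explicit MatrixLog
open T4AveragingDeficitWall (IsUnitaryCfg IsSkewDir SmallField vary)
open T4AveragingDeficitWallBoundary (IsPeriodicCfg periodBox)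
open AveragingDeficitTwoLevelPrep (prop1Radius twoLevelSmall)
open AveragingDeficitMultiLevelPrep (cavgIter LevelSmall tower)
open BlockAverageVaryHolo (nbRad)
open BlockAverageVaryDisc (rho0 rho0_pos)
open NE3EnergyShapes (IsUnitarySite IsPeriodicSite)
open NE3RightInverseSupLetters (frameC supC)
open NE3HatInvCurlLetters (supCurlC)
open NE3QbarIterCovLiftPrep (cruxC)
open NE3RightInverseSolveLetters (cruxC_nonneg)
open NE3SmoothRightInverseW (rightInvW)
open NE3LinearisedAverageSup (curv curvSum curvSum_le_of_levelSmall)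
open NE3TopRadiusLetters (loopRad_iterate_le_of_levelSmall)
open NE3ClassRadiusFamily (levelSmall_of_small)
open NE7MeanZeroGaugeSliceW (energyBlockLandauW)
open SpreadLift (loopRad)
open NE7SliceIterationState (repLog cornerLog coarseDatum)
open NE3TangentCovariantTower (framePotW)
open NE7SliceIterationState (tangentPart sliceDefect)
open NE7SliceTheoremFrames (slice_theorem_curved_fm)
open NE7SliceRepresentative (budget levelSmall_pair thetaP_line curvSum_line)

noncomputable section

variable {d : ℕ} {n : Type*} [Fintype n] [DecidableEq n]

/-! ## §2 The slice representative, one smallness hypothesis -/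

set_option maxHeartbeats 400000 in
/-- **THE SLICE REPRESENTATIVE OF A PAIR, ONE SMALLNESS HYPOTHESIS** (dimension `d+1 ≥ 2`, `L ≥ 2`, `b̂ ≥ 0`): `∃ ε₂ > 0, ∃ C_S > 0` (k-free; functions of `d, L, card n, b̂`) such that for
every level `k`, torus parameter `N`, unitary `(tower L N (k+1))`-periodic `W`, `U′` with `SmallField W (ε∕M²)`, `SmallField U′ (ε∕M²)`, `0 < ε ≤ ε₂`, and every unitary `(tower)`-periodic
corner-trivial `u₀` with `‖W(b)⁻¹U′^{u₀}(b) − 1‖ ≤ b̂·M·(ε∕M²)`: the class facts `LevelSmall (d+1) L k (ε∕M²)`, `LevelSmall (d+1) L (k+1) (ε∕M²)`, `cruxC·(M²·(ε∕M²)) < 1`,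
`curvSum (d+1) L (k+1) (ε∕M²) ≤ 2L∕3`, the line `4(3+12(d+1))²·M·(C_S·ε∕M) ≤ ρ₀²`, and a unitary `(tower)`-periodic `u⋆` with the chart `U′^{u⋆} = W·e^{X(u⋆)}`, `M·‖X(u⋆)‖ ≤ C_S·ε`,
corners `u⋆(M•z) = e^{h(u⋆) z}` with `‖h(u⋆)‖ ≤ C_S·ε`, and THE SLICE CONDITION in the `hslice` binder shape of `NE7DecompOfDirectLettersSlice.decomp_of_directLetters_coarse`
(`X₀ := repLog W U′ u⋆`, `φ := coarseDatum L k W U′ u⋆`, every proof argument of `rightInvW`). [folklore] -/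
theorem slice_representative_fm [Nonempty n] (hd : 1 ≤ d) {L : ℕ} (hL : 2 ≤ L) {bh : ℝ} (hbh : 0 ≤ bh) :
    ∃ ε₂ : ℝ, 0 < ε₂ ∧ ∃ CS : ℝ, 0 < CS ∧ ∀ (k N : ℕ) [NeZero N] (W U' : Site (d + 1) → Fin (d + 1) → (Matrix n n ℂ)ˣ) (ε : ℝ),
      0 < ε → ε ≤ ε₂ → IsUnitaryCfg W → IsPeriodicCfg W ((tower L N (k + 1) : ℕ) : ℤ) → SmallField W (ε / ((L : ℝ) ^ (k + 1)) ^ 2) →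
      IsUnitaryCfg U' → IsPeriodicCfg U' ((tower L N (k + 1) : ℕ) : ℤ) → SmallField U' (ε / ((L : ℝ) ^ (k + 1)) ^ 2) →
      ∀ {u₀ : Site (d + 1) → (Matrix n n ℂ)ˣ}, IsUnitarySite u₀ → IsPeriodicSite u₀ ((tower L N (k + 1) : ℕ) : ℤ) → (∀ z : Site (d + 1), u₀ (((L : ℤ) ^ (k + 1)) • z) = 1) →
      (∀ (y : Site (d + 1)) (κ : Fin (d + 1)), ‖(((W y κ)⁻¹ * gaugeAct u₀ U' y κ : (Matrix n n ℂ)ˣ) : Matrix n n ℂ) - 1‖ ≤ bh * (L : ℝ) ^ (k + 1) * (ε / ((L : ℝ) ^ (k + 1)) ^ 2)) →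
      LevelSmall (d + 1) L k (ε / ((L : ℝ) ^ (k + 1)) ^ 2) ∧ LevelSmall (d + 1) L (k + 1) (ε / ((L : ℝ) ^ (k + 1)) ^ 2) ∧
      cruxC (d + 1) L * (((L : ℝ) ^ (k + 1)) ^ 2 * (ε / ((L : ℝ) ^ (k + 1)) ^ 2)) < 1 ∧ curvSum (d + 1) L (k + 1) (ε / ((L : ℝ) ^ (k + 1)) ^ 2) ≤ 2 / 3 * L ∧
      4 * (3 + 12 * ((d + 1 : ℕ) : ℝ)) ^ 2 * (L : ℝ) ^ (k + 1) * (CS * ε / (L : ℝ) ^ (k + 1)) ≤ rho0 (d + 1) L ^ 2 ∧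
      ∃ ustar : Site (d + 1) → (Matrix n n ℂ)ˣ, IsUnitarySite ustar ∧ IsPeriodicSite ustar ((tower L N (k + 1) : ℕ) : ℤ) ∧
        gaugeAct ustar U' = vary W (repLog W U' ustar) 1 ∧
        (∀ (y : Site (d + 1)) (κ : Fin (d + 1)), (L : ℝ) ^ (k + 1) * ‖repLog W U' ustar y κ‖ ≤ CS * ε) ∧
        (∀ z : Site (d + 1), ((ustar (((L : ℤ) ^ (k + 1)) • z) : (Matrix n n ℂ)ˣ) : Matrix n n ℂ) = exp (cornerLog L k ustar z)) ∧
        (∀ z : Site (d + 1), ‖cornerLog L k ustar z‖ ≤ CS * ε) ∧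
        (∀ (hWu' : IsUnitaryCfg W) (hx' : 0 ≤ ε / ((L : ℝ) ^ (k + 1)) ^ 2) (hs' : LevelSmall (d + 1) L k (ε / ((L : ℝ) ^ (k + 1)) ^ 2))
            (hWx' : SmallField W (ε / ((L : ℝ) ^ (k + 1)) ^ 2)) (hθ' : cruxC (d + 1) L * (((L : ℝ) ^ (k + 1)) ^ 2 * (ε / ((L : ℝ) ^ (k + 1)) ^ 2)) < 1)
            (hφ : IsSkewDir (coarseDatum L k W U' ustar)),
          (fun y μ => repLog W U' ustar y μ - rightInvW hL k hWu' hx' hs' hWx' N hθ' hφ y μ) ∈ energyBlockLandauW (d := d + 1) (n := n) L N (k + 1) W) ∧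
        (∀ (hWu' : IsUnitaryCfg W) (hx' : 0 ≤ ε / ((L : ℝ) ^ (k + 1)) ^ 2) (hs' : LevelSmall (d + 1) L k (ε / ((L : ℝ) ^ (k + 1)) ^ 2))
            (hWx' : SmallField W (ε / ((L : ℝ) ^ (k + 1)) ^ 2)) (hθ' : cruxC (d + 1) L * (((L : ℝ) ^ (k + 1)) ^ 2 * (ε / ((L : ℝ) ^ (k + 1)) ^ 2)) < 1),
          (∀ z : Site (d + 1), framePotW L (k + 1) W (tangentPart hL k hWu' hx' hs' hWx' N hθ' U' ustar) z = cornerLog L k ustar z) ∧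
            sliceDefect hL k hWu' hx' hs' hWx' N hθ' U' ustar = 0) := by
  obtain ⟨K, hK, ε₁, hε₁, hcurved⟩ := slice_theorem_curved_fm (n := n) hd hL
  have hL1 : 1 ≤ L := by omega
  have hL2r : (2 : ℝ) ≤ L := by exact_mod_cast hL
  have hdd1 : (1 : ℝ) ≤ ((d + 1 : ℕ) : ℝ) := by exact_mod_cast (by omega : 1 ≤ d + 1)
  have hfC : 0 ≤ frameC (d + 1) L := by unfold frameC; positivity
  have hsC : 0 ≤ supC (d + 1) L := by
    unfold supC NE3RightInverseSupLetters.corrC NE3RightInverseSupLetters.frameC; have := NE3QbarIterCovLiftPrep.liftC_nonneg (d + 1); positivity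
  have hsCC : 0 ≤ supCurlC (d + 1) L := by
    unfold supCurlC NE3RightInverseSupLetters.frameC; have := NE3QbarIterCovLiftPrep.liftC_nonneg (d + 1); positivity
  have hcrux : 0 ≤ cruxC (d + 1) L := cruxC_nonneg (d + 1) L
  have hρ : 0 < rho0 (d + 1) L := rho0_pos (d := d + 1) hL1
  have hT : 0 ≤ twoLevelSmall (d + 1) L := by unfold twoLevelSmall; positivity
  obtain ⟨E, hE0, eh, ch, Cδ, CS, τ₀, hCSpos, hτ₀0, hτ₀1, hτ₀s, hτ₀C, heh, hch, hCδ, hCS, hbud⟩ :=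
    budget (K := K) (fC := frameC (d + 1) L) (sC := supC (d + 1) L) (sCC := supCurlC (d + 1) L) (crx := cruxC (d + 1) L) (ρ := rho0 (d + 1) L)
      (tls := twoLevelSmall (d + 1) L) (dd := ((d + 1 : ℕ) : ℝ)) (bh := bh) (ε₁ := ε₁) (Lr := (L : ℝ)) (nb := (nbRad (d + 1) L : ℝ))
      hK hfC hsC hsCC hcrux hρ hT hdd1 hbh hε₁ (by positivity) (by positivity)
  refine ⟨1 / E, by positivity, CS, hCSpos, ?_⟩
  intro k N _ W U' ε hε hεE hWu hWP hWx hU'u hU'P hU'x u₀ hu₀ hu₀P hpin hb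
  have hε0 : 0 ≤ ε := hε.le
  have hεE1 : ε * E ≤ 1 := by rwa [le_div_iff₀ hE0] at hεE
  obtain ⟨hε1', hεε₁, hb64', hls1, hls2, hθline, hCcline, hcrxline, hδmaxline, hCδτ, hS4, hSτ, hετ, hρl⟩ := hbud ε hε hεE1
  have hLpos : (0 : ℝ) < L := by exact_mod_cast (by omega : 0 < L)
  have hM0 : (0 : ℝ) < (L : ℝ) ^ (k + 1) := pow_pos hLpos _
  have hM1 : (1 : ℝ) ≤ (L : ℝ) ^ (k + 1) := one_le_pow₀ (by linarith only [hL2r])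
  have hx : 0 ≤ ε / ((L : ℝ) ^ (k + 1)) ^ 2 := div_nonneg hε0 (pow_nonneg hM0.le 2)
  have hMx : ((L : ℝ) ^ (k + 1)) ^ 2 * (ε / ((L : ℝ) ^ (k + 1)) ^ 2) = ε := by field_simp
  obtain ⟨hsk, hsk1⟩ := levelSmall_pair (d := d + 1) hL k hε0 hls1 hls2
  have hθc : cruxC (d + 1) L * (((L : ℝ) ^ (k + 1)) ^ 2 * (ε / ((L : ℝ) ^ (k + 1)) ^ 2)) ≤ 1 / 2 := by rw [hMx]; exact hcrxline
  have hθ : cruxC (d + 1) L * (((L : ℝ) ^ (k + 1)) ^ 2 * (ε / ((L : ℝ) ^ (k + 1)) ^ 2)) < 1 := hθc.trans_lt (by norm_num)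
  have hθP := thetaP_line (d := d + 1) (by omega) hL k hε0 hsk hθline
  have hA := curvSum_line (d := d + 1) hL k hε0 hsk hCcline
  have hρline : 4 * (3 + 12 * ((d + 1 : ℕ) : ℝ)) ^ 2 * (L : ℝ) ^ (k + 1) * (CS * ε / (L : ℝ) ^ (k + 1)) ≤ rho0 (d + 1) L ^ 2 := by
    have e : 4 * (3 + 12 * ((d + 1 : ℕ) : ℝ)) ^ 2 * (L : ℝ) ^ (k + 1) * (CS * ε / (L : ℝ) ^ (k + 1)) = 4 * (3 + 12 * ((d + 1 : ℕ) : ℝ)) ^ 2 * CS * ε := by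
      field_simp
    rw [e]; exact hρl
  have hbM : bh * (L : ℝ) ^ (k + 1) * (ε / ((L : ℝ) ^ (k + 1)) ^ 2) = bh * ε / (L : ℝ) ^ (k + 1) := by field_simp
  have hb' : ∀ (y : Site (d + 1)) (κ : Fin (d + 1)), ‖(((W y κ)⁻¹ * gaugeAct u₀ U' y κ : (Matrix n n ℂ)ˣ) : Matrix n n ℂ) - 1‖ ≤ bh * ε / (L : ℝ) ^ (k + 1) :=
    fun y κ => (hb y κ).trans (le_of_eq hbM)
  have hbε : bh * ε / (L : ℝ) ^ (k + 1) ≤ bh * ε := div_le_self (mul_nonneg hbh hε0) hM1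
  have hb64 : bh * ε / (L : ℝ) ^ (k + 1) ≤ 1 / 64 := by linarith only [hbε, hb64']
  have h1θ : 1 / 2 ≤ 1 - cruxC (d + 1) L * (((L : ℝ) ^ (k + 1)) ^ 2 * (ε / ((L : ℝ) ^ (k + 1)) ^ 2)) := by linarith only [hθc]
  have h1θ0 : 0 < 1 - cruxC (d + 1) L * (((L : ℝ) ^ (k + 1)) ^ 2 * (ε / ((L : ℝ) ^ (k + 1)) ^ 2)) := by linarith only [hθc]
  have hQ : (3 + 12 * ((d + 1 : ℕ) : ℝ)) * (L : ℝ) ^ (k + 1) * (2 * (bh * ε / (L : ℝ) ^ (k + 1))) = 2 * (3 + 12 * ((d + 1 : ℕ) : ℝ)) * bh * ε := by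
    field_simp
  have hdd0 : (0 : ℝ) ≤ ((d + 1 : ℕ) : ℝ) := Nat.cast_nonneg _
  have hQ0 : 0 ≤ 2 * (3 + 12 * ((d + 1 : ℕ) : ℝ)) * bh * ε :=
    mul_nonneg (mul_nonneg (mul_nonneg (by norm_num) (by linarith only [hdd0])) hbh) hε0
  have heE : 2 * (bh * ε / (L : ℝ) ^ (k + 1)) + supC (d + 1) L / ((L : ℝ) ^ (k + 1) * (1 - cruxC (d + 1) L * (((L : ℝ) ^ (k + 1)) ^ 2 * (ε / ((L : ℝ) ^ (k + 1)) ^ 2))))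
        * ((3 + 12 * ((d + 1 : ℕ) : ℝ)) * (L : ℝ) ^ (k + 1) * (2 * (bh * ε / (L : ℝ) ^ (k + 1)))) ≤ eh * ε / (L : ℝ) ^ (k + 1) := by
    have hfrac : supC (d + 1) L / ((L : ℝ) ^ (k + 1) * (1 - cruxC (d + 1) L * (((L : ℝ) ^ (k + 1)) ^ 2 * (ε / ((L : ℝ) ^ (k + 1)) ^ 2))))
        ≤ supC (d + 1) L / ((L : ℝ) ^ (k + 1) * (1 / 2)) :=
      div_le_div_of_nonneg_left hsC (mul_pos hM0 (by norm_num)) (mul_le_mul_of_nonneg_left h1θ hM0.le)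
    rw [hQ]
    calc 2 * (bh * ε / (L : ℝ) ^ (k + 1)) + supC (d + 1) L / ((L : ℝ) ^ (k + 1) * (1 - cruxC (d + 1) L * (((L : ℝ) ^ (k + 1)) ^ 2 * (ε / ((L : ℝ) ^ (k + 1)) ^ 2))))
          * (2 * (3 + 12 * ((d + 1 : ℕ) : ℝ)) * bh * ε)
        ≤ 2 * (bh * ε / (L : ℝ) ^ (k + 1)) + supC (d + 1) L / ((L : ℝ) ^ (k + 1) * (1 / 2)) * (2 * (3 + 12 * ((d + 1 : ℕ) : ℝ)) * bh * ε) :=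
          by linarith only [mul_le_mul_of_nonneg_right hfrac hQ0]
      _ = eh * ε / (L : ℝ) ^ (k + 1) := by rw [heh]; field_simp
  have hcE : (ε / ((L : ℝ) ^ (k + 1)) ^ 2 + ε / ((L : ℝ) ^ (k + 1)) ^ 2 + 48 * (2 * (bh * ε / (L : ℝ) ^ (k + 1))) ^ 2)
        + supCurlC (d + 1) L / (((L : ℝ) ^ (k + 1)) ^ 2 * (1 - cruxC (d + 1) L * (((L : ℝ) ^ (k + 1)) ^ 2 * (ε / ((L : ℝ) ^ (k + 1)) ^ 2))))
          * ((3 + 12 * ((d + 1 : ℕ) : ℝ)) * (L : ℝ) ^ (k + 1) * (2 * (bh * ε / (L : ℝ) ^ (k + 1)))) ≤ ch * ε / ((L : ℝ) ^ (k + 1)) ^ 2 := by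
    have hfrac : supCurlC (d + 1) L / (((L : ℝ) ^ (k + 1)) ^ 2 * (1 - cruxC (d + 1) L * (((L : ℝ) ^ (k + 1)) ^ 2 * (ε / ((L : ℝ) ^ (k + 1)) ^ 2))))
        ≤ supCurlC (d + 1) L / (((L : ℝ) ^ (k + 1)) ^ 2 * (1 / 2)) :=
      div_le_div_of_nonneg_left hsCC (mul_pos (pow_pos hM0 2) (by norm_num)) (mul_le_mul_of_nonneg_left h1θ (pow_nonneg hM0.le 2))
    have hsq : 48 * (2 * (bh * ε / (L : ℝ) ^ (k + 1))) ^ 2 = 192 * bh ^ 2 * (ε * ε) / ((L : ℝ) ^ (k + 1)) ^ 2 := by field_simp; ring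
    have hsq' : 192 * bh ^ 2 * (ε * ε) / ((L : ℝ) ^ (k + 1)) ^ 2 ≤ 192 * bh ^ 2 * ε / ((L : ℝ) ^ (k + 1)) ^ 2 := by
      apply div_le_div_of_nonneg_right _ (pow_nonneg hM0.le 2)
      have hεε : ε * ε ≤ ε := mul_le_of_le_one_left hε0 hε1'
      exact mul_le_mul_of_nonneg_left hεε (mul_nonneg (by norm_num) (sq_nonneg bh))
    rw [hQ, hsq]
    calc ε / ((L : ℝ) ^ (k + 1)) ^ 2 + ε / ((L : ℝ) ^ (k + 1)) ^ 2 + 192 * bh ^ 2 * (ε * ε) / ((L : ℝ) ^ (k + 1)) ^ 2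
          + supCurlC (d + 1) L / (((L : ℝ) ^ (k + 1)) ^ 2 * (1 - cruxC (d + 1) L * (((L : ℝ) ^ (k + 1)) ^ 2 * (ε / ((L : ℝ) ^ (k + 1)) ^ 2)))) * (2 * (3 + 12 * ((d + 1 : ℕ) : ℝ)) * bh * ε)
        ≤ ε / ((L : ℝ) ^ (k + 1)) ^ 2 + ε / ((L : ℝ) ^ (k + 1)) ^ 2 + 192 * bh ^ 2 * ε / ((L : ℝ) ^ (k + 1)) ^ 2
          + supCurlC (d + 1) L / (((L : ℝ) ^ (k + 1)) ^ 2 * (1 / 2)) * (2 * (3 + 12 * ((d + 1 : ℕ) : ℝ)) * bh * ε) :=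
          by linarith only [hsq', mul_le_mul_of_nonneg_right hfrac hQ0]
      _ = ch * ε / ((L : ℝ) ^ (k + 1)) ^ 2 := by rw [hch]; field_simp; ring
  have hδ₀ : (eh * ε / (L : ℝ) ^ (k + 1) + (2 * K * (L : ℝ) ^ (k + 1) * (ch * ε / ((L : ℝ) ^ (k + 1)) ^ 2)
          + 8 * K * (((L : ℝ) ^ (k + 1)) ^ 2 * (ε / ((L : ℝ) ^ (k + 1)) ^ 2)) * (frameC (d + 1) L * (L : ℝ) ^ (k + 1) * (eh * ε / (L : ℝ) ^ (k + 1)) + 0) / (L : ℝ) ^ (k + 1)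
          + 16 * K * ((d + 1 : ℕ) : ℝ) * (((L : ℝ) ^ (k + 1)) ^ 2 * (ε / ((L : ℝ) ^ (k + 1)) ^ 2)) * (eh * ε / (L : ℝ) ^ (k + 1))))
        + (frameC (d + 1) L * (L : ℝ) ^ (k + 1) * (eh * ε / (L : ℝ) ^ (k + 1)) + 0) / (L : ℝ) ^ (k + 1) ≤ Cδ * ε / (L : ℝ) ^ (k + 1) := by
    rw [hMx]
    have e1 : (eh * ε / (L : ℝ) ^ (k + 1) + (2 * K * (L : ℝ) ^ (k + 1) * (ch * ε / ((L : ℝ) ^ (k + 1)) ^ 2)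
          + 8 * K * ε * (frameC (d + 1) L * (L : ℝ) ^ (k + 1) * (eh * ε / (L : ℝ) ^ (k + 1)) + 0) / (L : ℝ) ^ (k + 1)
          + 16 * K * ((d + 1 : ℕ) : ℝ) * ε * (eh * ε / (L : ℝ) ^ (k + 1))))
        + (frameC (d + 1) L * (L : ℝ) ^ (k + 1) * (eh * ε / (L : ℝ) ^ (k + 1)) + 0) / (L : ℝ) ^ (k + 1)
        = (eh * ε / (L : ℝ) ^ (k + 1)) * (1 + frameC (d + 1) L + (8 * K * frameC (d + 1) L) * ε + (16 * K * ((d + 1 : ℕ) : ℝ)) * ε)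
          + 2 * K * ch * ε / (L : ℝ) ^ (k + 1) := by
      field_simp; ring
    have e2 : Cδ * ε / (L : ℝ) ^ (k + 1)
        = (eh * ε / (L : ℝ) ^ (k + 1)) * (1 + frameC (d + 1) L + 8 * K * frameC (d + 1) L + 16 * K * ((d + 1 : ℕ) : ℝ)) + 2 * K * ch * ε / (L : ℝ) ^ (k + 1) := by
      rw [hCδ]; field_simp
    rw [e1, e2]
    have heh0 : 0 ≤ eh := by rw [heh]; positivity
    have h0 : 0 ≤ eh * ε / (L : ℝ) ^ (k + 1) := div_nonneg (mul_nonneg heh0 hε0) hM0.le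
    have hin : 1 + frameC (d + 1) L + (8 * K * frameC (d + 1) L) * ε + (16 * K * ((d + 1 : ℕ) : ℝ)) * ε
        ≤ 1 + frameC (d + 1) L + 8 * K * frameC (d + 1) L + 16 * K * ((d + 1 : ℕ) : ℝ) := by
      have a1 : (8 * K * frameC (d + 1) L) * ε ≤ 8 * K * frameC (d + 1) L :=
        mul_le_of_le_one_right (mul_nonneg (mul_nonneg (by norm_num) hK.le) hfC) hε1'
      have a2 : (16 * K * ((d + 1 : ℕ) : ℝ)) * ε ≤ 16 * K * ((d + 1 : ℕ) : ℝ) :=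
        mul_le_of_le_one_right (mul_nonneg (mul_nonneg (by norm_num) hK.le) hdd0) hε1'
      linarith only [a1, a2]
    linarith only [mul_le_mul_of_nonneg_left hin h0]
  have hδmax : 6 * ((d + 1 : ℕ) : ℝ) * (L : ℝ) ^ (k + 1) * (Cδ * ε / (L : ℝ) ^ (k + 1)) ≤ 1 / 10000 := by
    have e : 6 * ((d + 1 : ℕ) : ℝ) * (L : ℝ) ^ (k + 1) * (Cδ * ε / (L : ℝ) ^ (k + 1)) = 6 * ((d + 1 : ℕ) : ℝ) * Cδ * ε := by field_simp
    rw [e]; exact hδmaxline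
  have hMδ : (L : ℝ) ^ (k + 1) * (Cδ * ε / (L : ℝ) ^ (k + 1)) ≤ τ₀ := by
    have e : (L : ℝ) ^ (k + 1) * (Cδ * ε / (L : ℝ) ^ (k + 1)) = Cδ * ε := by field_simp
    rw [e]; exact hCδτ
  have hSsum : 2 * (L : ℝ) ^ (k + 1) * (bh * ε / (L : ℝ) ^ (k + 1)) + 24 * ((d + 1 : ℕ) : ℝ) * (L : ℝ) ^ (k + 1) * (Cδ * ε / (L : ℝ) ^ (k + 1)) ≤ CS * ε := by
    have e : 2 * (L : ℝ) ^ (k + 1) * (bh * ε / (L : ℝ) ^ (k + 1)) + 24 * ((d + 1 : ℕ) : ℝ) * (L : ℝ) ^ (k + 1) * (Cδ * ε / (L : ℝ) ^ (k + 1)) = CS * ε := by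
      rw [hCS]; field_simp
    rw [e]
  have h4 : ((L : ℝ) ^ (k + 1)) ^ 2 * (ε / ((L : ℝ) ^ (k + 1)) ^ 2) ≤ τ₀ := by rw [hMx]; exact hετ
  have hC : 3000000 * (1 + 16 * K) * (1 + ((d + 1 : ℕ) : ℝ)) ^ 3 * (1 + frameC (d + 1) L) * (1 + supC (d + 1) L + supCurlC (d + 1) L) * τ₀ ≤ 1 / 2 := hτ₀C
  obtain ⟨ustar, hlu, hlP, hgl, hXl, hcl, hhl, -, hFM, hD0, hslice⟩ := hcurved k N W U' (ε / ((L : ℝ) ^ (k + 1)) ^ 2) (ε / ((L : ℝ) ^ (k + 1)) ^ 2) hWu hx hsk hWx hθ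
    hWP hU'u hU'P hθP (by rw [hMx]; exact hεε₁) (by rw [hMx]; exact hε1') hA hθc hx hU'x hτ₀0.le hτ₀1 hτ₀s hC h4 h4 hu₀ hu₀P hpin hb' hb64
    (eE := eh * ε / (L : ℝ) ^ (k + 1)) (cE := ch * ε / ((L : ℝ) ^ (k + 1)) ^ 2) (δ₀ := Cδ * ε / (L : ℝ) ^ (k + 1)) (S := CS * ε)
    heE hcE hδ₀ hδmax hMδ hSsum hS4 hSτ
  exact ⟨hsk, hsk1, hθ, hA, hρline, ustar, hlu, hlP, hgl, hXl, hcl, hhl, hslice, fun _ _ _ _ _ => ⟨hFM, hD0⟩⟩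

end

end Summit.QuantumFields.BalabanUV.T4Continuum.NE7SliceRepresentativeFrames
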